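/-
Copyright (c) 2026 the pub-hodgecm-mathlib formalisation cell (harness21).  Prover seat hodgecm-mathlib-K2E1-p13 (g5), Track B ∕ K2-LIT, h413 = `stmt-HodgeConjecture-24833`,
R90-TF section S8 «ContSpec-n½», S8 dealer R90-CS-plan (g3) S8-R192 (∞-2) «GENERAL BLOCKS: THE SHIFTED WITNESS», census `R90/S8/CENSUS-ArchSectionShiftedU3.K2E1-p13-g5.md`
51c4844f2a91ac38 — THEOREMS (file (β)) over ★ p864090 (file (α), the definitions): the structure of the SHIFTED archimedean section `archSectionShifted χ₁ χ₂ p q = archShiftFactor p q · archSectionE χ₁ χ₂`.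
-/
import Summits.HodgeConjecture.HodgeConjecture.Theorems.R90S8ChiSectionPairArchSectionShiftedU3Defs   -- ★ p864090 (this seat): `archLastRowS`, `archShiftFactor`, `archSectionShifted`
import Summits.HodgeConjecture.HodgeConjecture.Theorems.R90S8ChiSectionPairArchSectionWitnessEU3       -- ★ K2E1-p11 3c-E: `archSectionE_archPart_mul`, `archSectionE_one`, `continuous_archSectionE`, isotropy
import Summits.HodgeConjecture.HodgeConjecture.Theorems.K2E1ArchSectionLOnBigCellU3                     -- ★ p863919 (this seat): `archSectionE_midBlock_bigCell` (block of record on the big cell)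
import HarnessLib

/-!
# S8 (∞-2) — `R90S8ChiSectionPairArchSectionShiftedU3`: the SHIFTED archimedean section — Borel equivariance (inherited), modulus `≤` the section of record, `Φ(1) = 1`,
# continuity, and the BIG-CELL LAW `archShiftFactor p q = ∏_w ((Z_w+1)∕(Z_w−1))^{p_w}·((conj Z_w+1)∕(conj Z_w−1))^{q_w} = ∏_w ((2+ζ_w)∕ζ_w)^{p_w}·(conj…)^{q_w}`

Track B ∕ K2-LIT, crux h413 = `stmt-HodgeConjecture-24833`, route of record `HCCMUnconditional`; cell `hodgecm-mathlib`, R90-TF programme, section S8 «ContSpec-n½», road R2-χ₃, (V)(iii) row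
`hA32 : A(3∕2) ≠ 0` for GENERAL blocks (S8-R192 (∞-2): coupling exponents `|m_w| ≥ 3`).  THEOREMS ONLY (no `def`, no `instance`, no notation, no named-fact hypothesis, no `sorry`;
default heartbeats); lane `--supports stmt-HodgeConjecture-24833 --as helper` (count-neutral).  CLOSES NO SOCKET: it proves that the shifted section of ★ p864090 has EXACTLY the
letters `hΦac hΦaB hΦa1` of the section of record (so every consumer of ★ `archSectionE` may substitute it), is bounded by it in modulus, and reads on the big cell as the weight
`θ_w = ε_w·archUnitaryValue m_w 0 ζ_w·((2+ζ_w)∕ζ_w)^{p_w}` which file (γ) proves has a non-zero archimedean factor at `3∕2` for `p_w = (m_w−1)∕2` (every odd `m_w ≥ 1`; conjugate for `m_w ≤ −1`).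

THE MATHEMATICS (census; [BorelJacquet1979, §4.1]; [Rogawski1990, §1.9–§1.10]; [MoeglinWaldspurger1995, I.2.17, IV.1.11]).  The twist `∏_w (ι_w 𝓈_w ∕ ι_w ℓ_w)^{p_w}(conj ∕ conj)^{q_w}`,
`𝓈 = x₂ + x₀`, `ℓ = x₂ − x₀`, is homogeneous of degree `0` in the last row, which scales by `(b_∞)₂₂` under a left Borel translation (★ 3c `archLastRow_archPart_mul`) — so it is
INVARIANT and the shifted section has the same archimedean multiplier `χ₁((b_∞)₀₀)·χ₂((b_∞)₁₁)` as ★ `archSectionE` (§3).  By `J₃`-isotropy of the last row, `|𝓈_w|² = |ℓ_w|² − 2|x₁,w|²`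
(§2), so the twist has modulus `≤ 1` on ALL of `G_∞` and is continuous there (`ℓ_w ≠ 0`, ★ 3c-E).  On the big cell the last row is `(1, Ξ_w, Z_w)`, whence §5.
* §1 `𝓈`: `archLastRowS_archPart_mul`, `archLastRowS_one`, `continuous_archLastRowS`, complex coordinates `extensionEmbedding_archLastRowS_fst` ∕ `…L_fst`.
* §2 isotropy and modulus: `norm_sq_archLastRowS_fst`, `norm_archLastRowS_fst_le`, `norm_shiftRatio_le_one`, **`norm_archShiftFactor_le_one`**, `norm_archSectionShifted_le`.
* §3 **`archShiftFactor_archPart_mul`** (invariance), **`archSectionShifted_archPart_mul`** (the letter `hΦaB`).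
* §4 **`archShiftFactor_one`**, **`archSectionShifted_one`** (`hΦa1`), **`continuous_archShiftFactor`**, **`continuous_archSectionShifted`** (`hΦac`) — no unitarity hypothesis.
* §5 big cell: `archShiftFactor_eq_of_coords`, **`archShiftFactor_bigCell`** (`Z`-letter), **`archShiftFactor_bigCell_zeta`** (`ζ`-letter), **`archSectionShifted_midBlock_bigCell`** (block of
  record, over ★ `archSectionE_midBlock_bigCell`: `Φ^{p,q} = twist · ∏_w (−1)^{m_w} conj (archUnitaryValue m_w 0 (1 − conj Z_w)) · ξ.ψ⟨det⟩`, `m_w = kμ,w − 2eη,w`).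
HONEST LABEL: HC_CM is proved only modulo the 7 printed citations (2 remaining named inputs: hLiu418 = `stmt-HodgeConjecture-24832`, h413 = `stmt-HodgeConjecture-24833`) until
rung 0 closes; REL ≠ ★ ≠ BUILT; this file asserts no named fact and closes no socket ((∞-2) is ★ only with file (γ) and the (V)∕(R)′ consumers re-keyed to the finite level of
record); count-neutral.

## References
* [BorelJacquet1979] A. Borel, H. Jacquet, *Automorphic forms and automorphic representations*, Corvallis PSPM 33.1 (1979), §4.1.
* [Rogawski1990] J. D. Rogawski, *Automorphic Representations of Unitary Groups in Three Variables* (1990), §1.9–§1.10.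
* [MoeglinWaldspurger1995] C. Mœglin, J.-L. Waldspurger, *Spectral Decomposition and Eisenstein Series* (1995), I.2.17, IV.1.11.
-/

set_option autoImplicit false
set_option linter.dupNamespace false  -- the mandated namespace `…HodgeConjecture.HodgeConjecture.R90.S8` repeats the summit's segment

noncomputable section

open NumberField ComplexConjugate
open Literature.NumberTheory.Automorphic Literature.NumberTheory.Automorphic.UnitaryGroup Literature.NumberTheory.GaloisRepresentations AdelicGroupData
open Literature.NumberTheory.Automorphic.Arthur2013.Leaves.TECR
open Literature.NumberTheory.Automorphic.UnitaryGroup.AdelicCharactersDetQuasiSplit (antidiagonal_over_det_ne_zero)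
open Summit.HodgeConjecture.HodgeConjecture.Cruxes.H413.K2E1CharacterEisensteinU2Defs
open Summit.HodgeConjecture.HodgeConjecture.Cruxes.H413.K2E1CharacterEisensteinU3PairDefs
open Literature.NumberTheory.Rogawski1990 (OneDimAutRepH)
open Summit.HodgeConjecture.HodgeConjecture.Cruxes.H413.K2E1ArchSectionLOnBigCellU3 (archSectionE_midBlock_bigCell)

namespace Summit.HodgeConjecture.HodgeConjecture.R90.S8

variable (L : Type) [Field L] [NumberField L] [IsCMField L]

/-! ## §1 The `V₊`-functional `𝓈 = x₂ + x₀`: Borel scaling, value at `1`, continuity, complex coordinates -/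

/-- **`𝓈(b_∞·a) = (b_∞)₂₂ · 𝓈(a)`** — the whole last row scales by `b₂₂` (★ 3c `archLastRow_archPart_mul`). [cite: BorelJacquet1979, §4.1] -/
theorem archLastRowS_archPart_mul {b : (quasiSplit (↥(maximalRealSubfield L)) L (IsCMField.complexConj L) 3).Adelic}
    (hb : b ∈ borelAdelic (↥(maximalRealSubfield L)) L (IsCMField.complexConj L) 3)
    (a : arch (↥(maximalRealSubfield L)) L (IsCMField.complexConj L) 3 ((StdForm.antidiagonal 3).over L)) :
    archLastRowS L (archPart (↥(maximalRealSubfield L)) L (IsCMField.complexConj L) 3 ((StdForm.antidiagonal 3).over L) b * a) =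
      (diagEntryUnit (archToAdelic_archPart_mem_borelAdelic L hb) 2 : AdeleRing (𝓞 L) L) * archLastRowS L a := by
  rw [archLastRowS_def, archLastRowS_def, archLastRow_archPart_mul L hb, archLastRow_archPart_mul L hb, mul_add]

/-- `𝓈(1) = 1 + 0 = 1`. [folklore] -/
theorem archLastRowS_one : archLastRowS L 1 = 1 := by
  rw [archLastRowS_def, archLastRow_one, archLastRow_one, Matrix.one_apply_eq, Matrix.one_apply_ne (by decide), add_zero]

/-- `a ↦ 𝓈(a)` is continuous (★ 3b `continuous_archLastRow`). [cite: BorelJacquet1979, §4.1] -/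
theorem continuous_archLastRowS : Continuous (archLastRowS L) :=
  (continuous_archLastRow L 2).add (continuous_archLastRow L 0)

/-- `ι_w(𝓈(a)_w) = z₂ + z₀` in the complex coordinates `z_j = (a_w)₂ⱼ` of ★ 3c-E `extensionEmbedding_archLastRow_fst`. [cite: BorelJacquet1979, §4.1] -/
theorem extensionEmbedding_archLastRowS_fst (a : arch (↥(maximalRealSubfield L)) L (IsCMField.complexConj L) 3 ((StdForm.antidiagonal 3).over L)) (w : InfinitePlace L) :
    InfinitePlace.Completion.extensionEmbedding w ((archLastRowS L a).1 w) =
      evalC L ⟨w, IsTotallyComplex.isComplex w⟩ (((a : GL (Fin 3) (mixedEmbedding.mixedSpace L)) : Matrix (Fin 3) (Fin 3) (mixedEmbedding.mixedSpace L)) 2 2) +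
        evalC L ⟨w, IsTotallyComplex.isComplex w⟩ (((a : GL (Fin 3) (mixedEmbedding.mixedSpace L)) : Matrix (Fin 3) (Fin 3) (mixedEmbedding.mixedSpace L)) 2 0) := by
  have h : (archLastRowS L a).1 w = (archLastRow L a 2).1 w + (archLastRow L a 0).1 w := rfl
  rw [h, map_add, extensionEmbedding_archLastRow_fst, extensionEmbedding_archLastRow_fst]

/-- `ι_w(ℓ(a)_w) = z₂ − z₀`. [cite: BorelJacquet1979, §4.1] -/
theorem extensionEmbedding_archLastRowL_fst (a : arch (↥(maximalRealSubfield L)) L (IsCMField.complexConj L) 3 ((StdForm.antidiagonal 3).over L)) (w : InfinitePlace L) :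
    InfinitePlace.Completion.extensionEmbedding w ((archLastRowL L a).1 w) =
      evalC L ⟨w, IsTotallyComplex.isComplex w⟩ (((a : GL (Fin 3) (mixedEmbedding.mixedSpace L)) : Matrix (Fin 3) (Fin 3) (mixedEmbedding.mixedSpace L)) 2 2) -
        evalC L ⟨w, IsTotallyComplex.isComplex w⟩ (((a : GL (Fin 3) (mixedEmbedding.mixedSpace L)) : Matrix (Fin 3) (Fin 3) (mixedEmbedding.mixedSpace L)) 2 0) := by
  have h : (archLastRowL L a).1 w = (archLastRow L a 2).1 w - (archLastRow L a 0).1 w := rfl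
  rw [h, map_sub, extensionEmbedding_archLastRow_fst, extensionEmbedding_archLastRow_fst]

/-! ## §2 Isotropy: `|𝓈_w|² = |ℓ_w|² − 2|x₁,w|²`, so `|𝓈_w| ≤ |ℓ_w|` and `‖archShiftFactor p q a‖ ≤ 1` on ALL of `G_∞` -/

/-- **`‖𝓈(a)_w‖² = ‖ℓ(a)_w‖² − 2‖(x₁)_w‖²`** — from the `J₃`-isotropy of the last row `z₂z̄₀ + |z₁|² + z₀z̄₂ = 0` (★ 3c-E `archRow_isotropic`). [cite: Rogawski1990, §1.9] -/
theorem norm_sq_archLastRowS_fst (a : arch (↥(maximalRealSubfield L)) L (IsCMField.complexConj L) 3 ((StdForm.antidiagonal 3).over L)) (w : InfinitePlace L) :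
    ‖(archLastRowS L a).1 w‖ ^ 2 = ‖(archLastRowL L a).1 w‖ ^ 2 - 2 * ‖(archLastRow L a 1).1 w‖ ^ 2 := by
  rw [← Isometry.norm_map_of_map_zero (InfinitePlace.Completion.isometry_extensionEmbedding w) (map_zero _) ((archLastRowS L a).1 w),
    ← Isometry.norm_map_of_map_zero (InfinitePlace.Completion.isometry_extensionEmbedding w) (map_zero _) ((archLastRowL L a).1 w),
    extensionEmbedding_archLastRowS_fst, extensionEmbedding_archLastRowL_fst, norm_archLastRow_fst]
  set z : Fin 3 → ℂ := fun j =>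
    evalC L ⟨w, IsTotallyComplex.isComplex w⟩ (((a : GL (Fin 3) (mixedEmbedding.mixedSpace L)) : Matrix (Fin 3) (Fin 3) (mixedEmbedding.mixedSpace L)) 2 j) with hz
  have hiso : z 2 * conj (z 0) + z 1 * conj (z 1) + z 0 * conj (z 2) = 0 := archRow_isotropic L a w
  show ‖z 2 + z 0‖ ^ 2 = ‖z 2 - z 0‖ ^ 2 - 2 * ‖z 1‖ ^ 2
  have e : ∀ u : ℂ, ((‖u‖ : ℝ) : ℂ) ^ 2 = u * conj u := fun u => (Complex.mul_conj' u).symm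
  apply Complex.ofReal_injective
  push_cast
  rw [e, e, e, map_add, map_sub]
  linear_combination (2 : ℂ) * hiso

/-- **`‖𝓈(a)_w‖ ≤ ‖ℓ(a)_w‖`** at every archimedean place. [cite: Rogawski1990, §1.9] -/
theorem norm_archLastRowS_fst_le (a : arch (↥(maximalRealSubfield L)) L (IsCMField.complexConj L) 3 ((StdForm.antidiagonal 3).over L)) (w : InfinitePlace L) :
    ‖(archLastRowS L a).1 w‖ ≤ ‖(archLastRowL L a).1 w‖ := by
  have h := norm_sq_archLastRowS_fst L a w
  have h2 : ‖(archLastRowS L a).1 w‖ ^ 2 ≤ ‖(archLastRowL L a).1 w‖ ^ 2 := by rw [h]; nlinarith [sq_nonneg ‖(archLastRow L a 1).1 w‖]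
  exact (pow_le_pow_iff_left₀ (norm_nonneg _) (norm_nonneg _) two_ne_zero).1 h2

/-- `ι_w(ℓ(a)_w) ≠ 0` (★ 3c-E `archLastRowL_fst_ne_zero`, `ι_w` injective). [cite: Rogawski1990, §1.9] -/
theorem extensionEmbedding_archLastRowL_fst_ne_zero (a : arch (↥(maximalRealSubfield L)) L (IsCMField.complexConj L) 3 ((StdForm.antidiagonal 3).over L)) (w : InfinitePlace L) :
    InfinitePlace.Completion.extensionEmbedding w ((archLastRowL L a).1 w) ≠ 0 :=
  (map_ne_zero_iff _ (RingHom.injective _)).2 (archLastRowL_fst_ne_zero L a w)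

/-- **`‖ι_w 𝓈_w ∕ ι_w ℓ_w‖ ≤ 1`**: the twist ratio at one place has modulus at most one. [cite: Rogawski1990, §1.9] -/
theorem norm_shiftRatio_le_one (a : arch (↥(maximalRealSubfield L)) L (IsCMField.complexConj L) 3 ((StdForm.antidiagonal 3).over L)) (w : InfinitePlace L) :
    ‖InfinitePlace.Completion.extensionEmbedding w ((archLastRowS L a).1 w) / InfinitePlace.Completion.extensionEmbedding w ((archLastRowL L a).1 w)‖ ≤ 1 := by
  rw [norm_div, Isometry.norm_map_of_map_zero (InfinitePlace.Completion.isometry_extensionEmbedding w) (map_zero _),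
    Isometry.norm_map_of_map_zero (InfinitePlace.Completion.isometry_extensionEmbedding w) (map_zero _)]
  exact div_le_one_of_le₀ (norm_archLastRowS_fst_le L a w) (norm_nonneg _)

/-- **`‖archShiftFactor p q a‖ ≤ 1` on all of `G_∞`** (each place contributes `(‖𝓈_w‖∕‖ℓ_w‖)^{p_w + q_w} ≤ 1`). [cite: Rogawski1990, §1.9] -/
theorem norm_archShiftFactor_le_one (p q : InfinitePlace L → ℕ) (a : arch (↥(maximalRealSubfield L)) L (IsCMField.complexConj L) 3 ((StdForm.antidiagonal 3).over L)) :
    ‖archShiftFactor L p q a‖ ≤ 1 := by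
  rw [archShiftFactor_def, norm_prod]
  refine Finset.prod_le_one (fun w _ => norm_nonneg _) fun w _ => ?_
  have h := norm_shiftRatio_le_one L a w
  rw [← map_div₀ (starRingEnd ℂ), norm_mul, norm_pow, norm_pow, Complex.norm_conj]
  exact mul_le_one₀ (pow_le_one₀ (norm_nonneg _) h) (pow_nonneg (norm_nonneg _) _) (pow_le_one₀ (norm_nonneg _) h)

/-- **`‖archSectionShifted χ₁ χ₂ p q a‖ ≤ ‖archSectionE χ₁ χ₂ a‖`** — the shift never increases the modulus. [cite: Rogawski1990, §1.10] -/
theorem norm_archSectionShifted_le (χ₁ : HeckeCharacter L) (χ₂ : ↥(TorusDict.torus (IsCMField.complexConj L)) →ₜ* ℂˣ) (p q : InfinitePlace L → ℕ)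
    (a : arch (↥(maximalRealSubfield L)) L (IsCMField.complexConj L) 3 ((StdForm.antidiagonal 3).over L)) :
    ‖archSectionShifted L χ₁ χ₂ p q a‖ ≤ ‖archSectionE L χ₁ χ₂ a‖ := by
  rw [archSectionShifted_def, norm_mul]
  exact mul_le_of_le_one_left (norm_nonneg _) (norm_archShiftFactor_le_one L p q a)

/-! ## §3 Borel invariance of the twist and equivariance of the shifted section (INHERITED from ★ `archSectionE_archPart_mul`) -/

/-- **`archShiftFactor p q (b_∞·a) = archShiftFactor p q a`** — numerator and denominator both scale by `ι_w((b_∞)₂₂)_w ≠ 0`. [cite: BorelJacquet1979, §4.1] [cite: Rogawski1990, §1.10] -/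
theorem archShiftFactor_archPart_mul (p q : InfinitePlace L → ℕ) {b : (quasiSplit (↥(maximalRealSubfield L)) L (IsCMField.complexConj L) 3).Adelic}
    (hb : b ∈ borelAdelic (↥(maximalRealSubfield L)) L (IsCMField.complexConj L) 3)
    (a : arch (↥(maximalRealSubfield L)) L (IsCMField.complexConj L) 3 ((StdForm.antidiagonal 3).over L)) :
    archShiftFactor L p q (archPart (↥(maximalRealSubfield L)) L (IsCMField.complexConj L) 3 ((StdForm.antidiagonal 3).over L) b * a) = archShiftFactor L p q a := by
  rw [archShiftFactor_def, archShiftFactor_def]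
  refine Finset.prod_congr rfl fun w _ => ?_
  set d : AdeleRing (𝓞 L) L := (diagEntryUnit (archToAdelic_archPart_mem_borelAdelic L hb) 2 : AdeleRing (𝓞 L) L) with hd
  have hd0 : d.1 w ≠ 0 :=
    ((Units.isUnit (diagEntryUnit (archToAdelic_archPart_mem_borelAdelic L hb) 2)).map
      ((Pi.evalRingHom (fun v : InfinitePlace L => v.Completion) w).comp (adeleFst L))).ne_zero
  have hD : InfinitePlace.Completion.extensionEmbedding w (d.1 w) ≠ 0 := (map_ne_zero_iff _ (RingHom.injective _)).2 hd0
  have hS : (archLastRowS L (archPart (↥(maximalRealSubfield L)) L (IsCMField.complexConj L) 3 ((StdForm.antidiagonal 3).over L) b * a)).1 w =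
      d.1 w * (archLastRowS L a).1 w := by
    rw [archLastRowS_archPart_mul L hb]
    rfl
  have hL : (archLastRowL L (archPart (↥(maximalRealSubfield L)) L (IsCMField.complexConj L) 3 ((StdForm.antidiagonal 3).over L) b * a)).1 w =
      d.1 w * (archLastRowL L a).1 w := by
    rw [archLastRowL_archPart_mul L hb]
    rfl
  rw [hS, hL]
  simp only [map_mul]
  rw [mul_div_mul_left _ _ hD, mul_div_mul_left _ _ ((map_ne_zero _).2 hD)]

/-- **`Φ^{p,q}(b_∞·a) = χ₁((b_∞)₀₀)·χ₂((b_∞)₁₁)·Φ^{p,q}(a)`** — the SAME archimedean multiplier as the section of record (★ 3c-E `archSectionE_archPart_mul`; the twist is invariant).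
[cite: Rogawski1990, §1.10] [cite: BorelJacquet1979, §4.1] -/
theorem archSectionShifted_archPart_mul (χ₁ : HeckeCharacter L) (χ₂ : ↥(TorusDict.torus (IsCMField.complexConj L)) →ₜ* ℂˣ) (p q : InfinitePlace L → ℕ)
    {b : (quasiSplit (↥(maximalRealSubfield L)) L (IsCMField.complexConj L) 3).Adelic} (hb : b ∈ borelAdelic (↥(maximalRealSubfield L)) L (IsCMField.complexConj L) 3)
    (a : arch (↥(maximalRealSubfield L)) L (IsCMField.complexConj L) 3 ((StdForm.antidiagonal 3).over L)) :
    archSectionShifted L χ₁ χ₂ p q (archPart (↥(maximalRealSubfield L)) L (IsCMField.complexConj L) 3 ((StdForm.antidiagonal 3).over L) b * a) =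
      (((χ₁ (firstEntryUnit (archToAdelic_archPart_mem_borelAdelic L hb)) : ℂˣ) : ℂ) * ((χ₂ (middleEntryUnitary (archToAdelic_archPart_mem_borelAdelic L hb)) : ℂˣ) : ℂ)) *
        archSectionShifted L χ₁ χ₂ p q a := by
  rw [archSectionShifted_def, archSectionShifted_def, archShiftFactor_archPart_mul L p q hb, archSectionE_archPart_mul L χ₁ χ₂ hb, mul_left_comm]

/-! ## §4 The value at `1` and continuity (no unitarity hypothesis) -/

/-- **`archShiftFactor p q 1 = 1`** (`𝓈(1) = ℓ(1) = 1`). [folklore] -/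
theorem archShiftFactor_one (p q : InfinitePlace L → ℕ) : archShiftFactor L p q 1 = 1 := by
  rw [archShiftFactor_def]
  refine Finset.prod_eq_one fun w _ => ?_
  have hS : (archLastRowS L 1).1 w = 1 := by rw [archLastRowS_one]; rfl
  have hL : (archLastRowL L 1).1 w = 1 := by rw [archLastRowL_one]; rfl
  rw [hS, hL]
  simp only [map_one, div_one, one_pow, mul_one]

/-- **`Φ^{p,q}(1) = 1`** (★ 3c-E `archSectionE_one`). [folklore] -/
theorem archSectionShifted_one (χ₁ : HeckeCharacter L) (χ₂ : ↥(TorusDict.torus (IsCMField.complexConj L)) →ₜ* ℂˣ) (p q : InfinitePlace L → ℕ) :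
    archSectionShifted L χ₁ χ₂ p q 1 = 1 := by
  rw [archSectionShifted_def, archShiftFactor_one, archSectionE_one, mul_one]

/-- **`archShiftFactor p q` IS CONTINUOUS on `G_∞`** (the denominators `ι_w ℓ(a)_w` never vanish, ★ 3c-E). [cite: BorelJacquet1979, §4.1] -/
theorem continuous_archShiftFactor (p q : InfinitePlace L → ℕ) : Continuous (archShiftFactor L p q) := by
  have hdef : archShiftFactor L p q = fun a => ∏ w : InfinitePlace L,
      (InfinitePlace.Completion.extensionEmbedding w ((archLastRowS L a).1 w) / InfinitePlace.Completion.extensionEmbedding w ((archLastRowL L a).1 w)) ^ p w *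
        (conj (InfinitePlace.Completion.extensionEmbedding w ((archLastRowS L a).1 w)) / conj (InfinitePlace.Completion.extensionEmbedding w ((archLastRowL L a).1 w))) ^ q w :=
    funext (archShiftFactor_def L p q)
  rw [hdef]
  refine continuous_finsetProd _ fun w _ => ?_
  have hE : Continuous (InfinitePlace.Completion.extensionEmbedding w) := (InfinitePlace.Completion.isometry_extensionEmbedding w).continuous
  have hS : Continuous fun a : arch (↥(maximalRealSubfield L)) L (IsCMField.complexConj L) 3 ((StdForm.antidiagonal 3).over L) =>
      InfinitePlace.Completion.extensionEmbedding w ((archLastRowS L a).1 w) :=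
    hE.comp ((continuous_apply w).comp (continuous_fst.comp (continuous_archLastRowS L)))
  have hL : Continuous fun a : arch (↥(maximalRealSubfield L)) L (IsCMField.complexConj L) 3 ((StdForm.antidiagonal 3).over L) =>
      InfinitePlace.Completion.extensionEmbedding w ((archLastRowL L a).1 w) :=
    hE.comp ((continuous_apply w).comp (continuous_fst.comp (continuous_archLastRowL L)))
  have hL0 := extensionEmbedding_archLastRowL_fst_ne_zero L
  exact ((hS.div hL fun a => hL0 a w).pow _).mul
    (((Complex.continuous_conj.comp hS).div (Complex.continuous_conj.comp hL) fun a => (map_ne_zero _).2 (hL0 a w)).pow _)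

/-- **`Φ^{p,q} = archSectionShifted χ₁ χ₂ p q` IS CONTINUOUS on `G_∞` — for EVERY pair `(χ₁, χ₂)`** (★ 3c-E `continuous_archSectionE`). [cite: BorelJacquet1979, §4.1] [cite: Rogawski1990, §1.10] -/
theorem continuous_archSectionShifted (χ₁ : HeckeCharacter L) (χ₂ : ↥(TorusDict.torus (IsCMField.complexConj L)) →ₜ* ℂˣ) (p q : InfinitePlace L → ℕ) :
    Continuous (archSectionShifted L χ₁ χ₂ p q) := by
  have hdef : archSectionShifted L χ₁ χ₂ p q = fun a => archShiftFactor L p q a * archSectionE L χ₁ χ₂ a := funext (archSectionShifted_def L χ₁ χ₂ p q)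
  rw [hdef]
  exact (continuous_archShiftFactor L p q).mul (continuous_archSectionE L χ₁ χ₂)

/-! ## §5 The big cell: last row `(1, Ξ_w, Z_w)`, twist `((Z_w + 1)∕(Z_w − 1))^{p_w}·(conj…)^{q_w} = ((2 + ζ_w)∕ζ_w)^{p_w}·(conj…)^{q_w}` -/

/-- The twist read on PRESCRIBED complex coordinates of `𝓈` and `ℓ`. [cite: BorelJacquet1979, §4.1] -/
theorem archShiftFactor_eq_of_coords (p q : InfinitePlace L → ℕ) (a : arch (↥(maximalRealSubfield L)) L (IsCMField.complexConj L) 3 ((StdForm.antidiagonal 3).over L))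
    (S ℓ : InfinitePlace L → ℂ) (hS : ∀ w : InfinitePlace L, InfinitePlace.Completion.extensionEmbedding w ((archLastRowS L a).1 w) = S w)
    (hℓ : ∀ w : InfinitePlace L, InfinitePlace.Completion.extensionEmbedding w ((archLastRowL L a).1 w) = ℓ w) :
    archShiftFactor L p q a = ∏ w : InfinitePlace L, (S w / ℓ w) ^ p w * (conj (S w) / conj (ℓ w)) ^ q w := by
  rw [archShiftFactor_def]
  exact Finset.prod_congr rfl fun w _ => by rw [hS w, hℓ w]

/-- **BIG-CELL LAW.**  If the last row of `a` at every place is `(1, Ξ_w, Z_w)` (`ι_w (x₀)_w = 1`, `ι_w (x₂)_w = Z_w` — the element `ι(w₀)·u(Ξ, a)` of ★ (a2)₃), then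
`archShiftFactor p q a = ∏_w ((Z_w + 1)∕(Z_w − 1))^{p_w} · ((conj Z_w + 1)∕(conj Z_w − 1))^{q_w}`. [cite: MoeglinWaldspurger1995, IV.1.11] [cite: BorelJacquet1979, §4.1] -/
theorem archShiftFactor_bigCell (p q : InfinitePlace L → ℕ) (a : arch (↥(maximalRealSubfield L)) L (IsCMField.complexConj L) 3 ((StdForm.antidiagonal 3).over L))
    (Z : InfinitePlace L → ℂ) (h0 : ∀ w : InfinitePlace L, InfinitePlace.Completion.extensionEmbedding w ((archLastRow L a 0).1 w) = 1)
    (h2 : ∀ w : InfinitePlace L, InfinitePlace.Completion.extensionEmbedding w ((archLastRow L a 2).1 w) = Z w) :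
    archShiftFactor L p q a = ∏ w : InfinitePlace L, ((Z w + 1) / (Z w - 1)) ^ p w * ((conj (Z w) + 1) / (conj (Z w) - 1)) ^ q w := by
  refine archShiftFactor_eq_of_coords L p q a (fun w => Z w + 1) (fun w => Z w - 1) (fun w => ?_) (fun w => ?_) ▸ ?_
  · have h : (archLastRowS L a).1 w = (archLastRow L a 2).1 w + (archLastRow L a 0).1 w := rfl
    rw [h, map_add, h0, h2]
  · have h : (archLastRowL L a).1 w = (archLastRow L a 2).1 w - (archLastRow L a 0).1 w := rfl
    rw [h, map_sub, h0, h2]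
  · refine Finset.prod_congr rfl fun w _ => ?_
    rw [map_add, map_sub, map_one]

/-- **BIG-CELL LAW IN THE `ζ`-LETTER** (`ζ_w = Z_w − 1 = ι_w ℓ_w`, ★ (a-10c)): `archShiftFactor p q a = ∏_w ((2 + ζ_w)∕ζ_w)^{p_w} · ((2 + conj ζ_w)∕conj ζ_w)^{q_w}`. [cite: MoeglinWaldspurger1995, IV.1.11] -/
theorem archShiftFactor_bigCell_zeta (p q : InfinitePlace L → ℕ) (a : arch (↥(maximalRealSubfield L)) L (IsCMField.complexConj L) 3 ((StdForm.antidiagonal 3).over L))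
    (ζ : InfinitePlace L → ℂ) (h0 : ∀ w : InfinitePlace L, InfinitePlace.Completion.extensionEmbedding w ((archLastRow L a 0).1 w) = 1)
    (hℓ : ∀ w : InfinitePlace L, InfinitePlace.Completion.extensionEmbedding w ((archLastRowL L a).1 w) = ζ w) :
    archShiftFactor L p q a = ∏ w : InfinitePlace L, ((2 + ζ w) / ζ w) ^ p w * ((2 + conj (ζ w)) / conj (ζ w)) ^ q w := by
  refine archShiftFactor_eq_of_coords L p q a (fun w => 2 + ζ w) ζ (fun w => ?_) hℓ ▸ ?_
  · have h : (archLastRowS L a).1 w = (archLastRowL L a).1 w + 2 * (archLastRow L a 0).1 w := by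
      have e1 : (archLastRowS L a).1 w = (archLastRow L a 2).1 w + (archLastRow L a 0).1 w := rfl
      have e2 : (archLastRowL L a).1 w = (archLastRow L a 2).1 w - (archLastRow L a 0).1 w := rfl
      rw [e1, e2]
      ring
    rw [h, map_add, map_mul, map_ofNat, h0, hℓ, mul_one, add_comm]
  · refine Finset.prod_congr rfl fun w _ => ?_
    rw [map_add, map_ofNat]

/-- **THE SHIFTED SECTION FOR THE BLOCK OF RECORD ON THE BIG CELL** (`χ₁ = ξ.bcη⁻¹·ξ.bcψ⁻¹·μω`, `μω` of type `(kμ, 0)`, `χ₂ = ξ.ψ`; ★ K2E1-p13 `archSectionE_midBlock_bigCell`):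
`Φ^{p,q}(a) = (∏_w ((Z_w+1)∕(Z_w−1))^{p_w}((conj Z_w+1)∕(conj Z_w−1))^{q_w}) · (∏_w (−1)^{m_w} conj (archUnitaryValue m_w 0 (1 − conj Z_w))) · ξ.ψ⟨det ι_∞ a⟩`, `m_w = kμ,w − 2eη,w` — the
weight `θ_w` that file (γ) feeds to the ★ (a-10) engine with `p_w = (m_w − 1)∕2` (`m_w ≥ 1`) ∕ `q_w = (|m_w| − 1)∕2` (`m_w ≤ −1`). [cite: MoeglinWaldspurger1995, IV.1.11] [cite: Rogawski1990, §1.10] -/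
theorem archSectionShifted_midBlock_bigCell (ξ : OneDimAutRepH L) {μω : HeckeCharacter L} {kμ : InfinitePlace L → ℤ} (hμ : μω.HasUnitaryArchType kμ 0)
    (p q : InfinitePlace L → ℕ) (a : arch (↥(maximalRealSubfield L)) L (IsCMField.complexConj L) 3 ((StdForm.antidiagonal 3).over L)) (y : (InfiniteAdeleRing L)ˣ)
    (Z : InfinitePlace L → ℂ) (hℓ : archLastRowL L a = ((infiniteIdeles L y : ideleGroup L) : AdeleRing (𝓞 L) L))
    (hy : ∀ w : InfinitePlace L, InfinitePlace.Completion.extensionEmbedding w ((y : InfiniteAdeleRing L) w) = Z w - 1)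
    (h0 : ∀ w : InfinitePlace L, InfinitePlace.Completion.extensionEmbedding w ((archLastRow L a 0).1 w) = 1)
    (h2 : ∀ w : InfinitePlace L, InfinitePlace.Completion.extensionEmbedding w ((archLastRow L a 2).1 w) = Z w) :
    archSectionShifted L (ξ.bcη⁻¹ * ξ.bcψ⁻¹ * μω) ξ.ψ p q a =
      (∏ w : InfinitePlace L, ((Z w + 1) / (Z w - 1)) ^ p w * ((conj (Z w) + 1) / (conj (Z w) - 1)) ^ q w) *
        ((∏ w : InfinitePlace L, (-1) ^ (kμ w - 2 * ξ.eη w) * conj (archUnitaryValue (kμ w - 2 * ξ.eη w) 0 (1 - conj (Z w)))) *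
          ((adelicOneChar (↥(maximalRealSubfield L)) L (IsCMField.complexConj L) ξ.ψ
            (adelicDet (↥(maximalRealSubfield L)) L (IsCMField.complexConj L) 3 ((StdForm.antidiagonal 3).over L) (antidiagonal_over_det_ne_zero L 3)
              (archToAdelic (↥(maximalRealSubfield L)) L (IsCMField.complexConj L) 3 ((StdForm.antidiagonal 3).over L) a)) : ℂˣ) : ℂ)) := by
  rw [archSectionShifted_def, archShiftFactor_bigCell L p q a Z h0 h2, archSectionE_midBlock_bigCell L ξ hμ a y Z hℓ hy]

end Summit.HodgeConjecture.HodgeConjecture.R90.S8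

end
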